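import Literature.NumberTheory.GaloisRepresentations.LocalCanonicalFundamentalClass
import HarnessLib

/-!
# The canonical local fundamental classes along a tower: `Br(L/K) = Br(K)[[L:K]]` and
# `Inf u_{L/K} = [L':L] · u_{L'/K}` in `Br(K)` (Serre, *Local Fields* XIII §3 Cor. 1–3 to Prop. 7, §4)

Topic `NumberTheory/GaloisRepresentations` (local class field theory); namespace
`Literature.NumberTheory.GaloisRepresentations.UnitsLayer`.  Proof file: theorems only (no definition,
no named fact, no instance, no notation; D-0026).  Sequel to `LocalCanonicalFundamentalClass`
(`inv_K ∘ unitsInfTwo : H²(Gal(L/K), Lˣ) ⥲ (1/[L:K])ℤ/ℤ`, the canonical class `u_{L/K} ↦ 1/[L:K]`).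

For a non-archimedean local field `K : Type` of characteristic `0` and finite Galois layers
`L, L' ⊆ K̄`:

* §1 **`mem_range_unitsInfTwo_iff_nsmul_eq_zero`, `range_unitsInfTwo_eq`**: the relative Brauer group
  `Br(L/K) = unitsInfTwo(H²(Gal(L/K), Lˣ)) ⊆ Br(K) = H²(K, K̄ˣ)` IS the `[L:K]`-torsion of `Br(K)` (Serre
  XIII §3 Cor. 2: "`Br(L/K) = H²(L/K)` is the subgroup of `Br(K)` of elements of order dividing `n`").
* §2 **`range_unitsInfTwo_subset_of_dvd`** (`[L:K] ∣ [L':K] ⟹ Br(L/K) ⊆ Br(L'/K)`),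
  `range_unitsInfTwo_eq_of_finrank_eq` (Cor. 3: `Br(L/K)` depends only on `[L:K]`), and the ABSTRACT
  INFLATION **`existsUnique_unitsInfTwo_eq_of_dvd`**: for `[L:K] ∣ [L':K]` every class of `H²(L/K)` is the
  image-in-`Br(K)` of exactly one class of `H²(L'/K)` — for `L ⊆ L'` this is `Inf : H²(L/K) ↪ H²(L'/K)`
  read inside `Br(K)` (Serre X §4 Prop. 6), stated without the engine's cochain-level inflation.
* §3 **`unitsInfTwo_eq_unitsInfTwo_nsmul_of_inv_eq`**: the canonical classes are COHERENT —
  `u_{L/K}` and `[L':L] · u_{L'/K}` have the same image in `Br(K)` whenever `[L':K] = [L:K]·[L':L]`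
  ("`Inf(u_{L/K}) = [L':L] u_{L'/K}`", Serre XI §3 / XIII §4: the axiom of a class FORMATION relating the
  fundamental classes of the layers); `unitsInfTwo_eq_of_inv_eq` (same invariant `1/n` ⟹ same
  Brauer class, e.g. every layer of degree `m` has the Brauer class of the unramified `u_{K_m/K} =
  −[c_σ·π_K]`); `zmodToQmodZ_one_eq` (`1/[L:K]` as an element of `ℚ/ℤ`, uniformly in `[L:K] ≥ 1`).

With `LocalCanonicalFundamentalClass` this completes, at the level of Brauer classes, the local class
FORMATION `(Γ_K, K̄ˣ)` with canonical invariants in the tree's normalisation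
(`Prop121vii.brauerInvariantEquiv`): class modules at every layer (door-c6 g9), canonical generators
with `inv = 1/[L:K]`, coherence along towers.  Not here: the identification of the abstract inflation
with the engine's cochain-level `Inf` on `Rep.ofAlgebraAutOnUnits`, and restriction to `L/E` across the
two algebraic closures `K̄`, `Ē`.  HONEST FRAMING: classical local class field theory, written as the
local input of the Poitou–Tate assembly (Route A) of the bsd-schneider cell; no case of BSD is touched.

## References
* J.-P. Serre, *Local Fields*, GTM 67 (1979), Ch. XIII §3 Prop. 7 and Cor. 1–3, §4; Ch. XI §3 (class
  formations: `inv ∘ Inf`, `u_{L/K}`); Ch. X §4 Prop. 6. [SerreLocalFields1979]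
* J. Neukirch, *Class Field Theory — The Bonn Lectures* (2013), Part II §1 Def. (1.2)–(1.3) (class
  formation axioms), §5 (5.5)–(5.6). [Neukirch2013]
-/

noncomputable section

open CategoryTheory groupCohomology Field Function

namespace Literature.NumberTheory.GaloisRepresentations

namespace UnitsLayer

open Literature.Algebra.Homology DiscreteGaloisModule
open Literature.AnabelianGeometry.AbsoluteAnabelian.Prop121vii

section Tower

variable (K : Type) [Field K] [ValuativeRel K] [TopologicalSpace K] [IsNonarchimedeanLocalField K]
  [CharZero K]
variable (L : IntermediateField K (AlgebraicClosure K)) [FiniteDimensional K L] [IsGalois K L]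
variable (L' : IntermediateField K (AlgebraicClosure K)) [FiniteDimensional K L'] [IsGalois K L']

/-! ## §1. `Br(L/K) = Br(K)[[L:K]]` -/

/-- **`Br(L/K)` is the `[L:K]`-torsion of `Br(K)`**: a class `c ∈ H²(K, K̄ˣ)` is inflated from
`H²(Gal(L/K), Lˣ)` iff `[L:K] · c = 0` (Serre XIII §3 Cor. 2 to Prop. 7).  `⟹`: `H²(L/K)` has exponent
`[L:K]`; `⟸`: `inv_K(c)` is `[L:K]`-torsion, hence in `(1/[L:K])ℤ/ℤ = inv_K(Br(L/K))`
(`range_brauerInvariantEquiv_unitsInfTwo`), and `inv_K` is injective.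
[cite: SerreLocalFields1979, Ch. XIII §3 Cor. 2 to Prop. 7] -/
theorem mem_range_unitsInfTwo_iff_nsmul_eq_zero (c : galoisCohomology (units K) 2) :
    c ∈ Set.range (unitsInfTwo K L) ↔ Module.finrank K L • c = 0 := by
  constructor
  · rintro ⟨x, rfl⟩
    rw [← map_nsmul, finrank_nsmul_eq_zero K L x, map_zero]
  · intro hc
    haveI : NeZero (Module.finrank K L) := ⟨Module.finrank_pos.ne'⟩
    have hinv : brauerInvariantEquiv K c ∈ Set.range (zmodToQmodZ (Module.finrank K L)) :=
      mem_range_zmodToQmodZ_of_nsmul_eq_zero _ _ (by rw [← map_nsmul, hc, map_zero])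
    rw [← range_brauerInvariantEquiv_unitsInfTwo K L rfl] at hinv
    obtain ⟨x, hx⟩ := hinv
    exact ⟨x, (brauerInvariantEquiv K).injective hx⟩

/-- `Br(L/K) = {c ∈ Br(K) | [L:K] · c = 0}` as sets. [cite: SerreLocalFields1979, Ch. XIII §3 Cor. 2 to Prop. 7] -/
theorem range_unitsInfTwo_eq :
    Set.range (unitsInfTwo K L) = {c : galoisCohomology (units K) 2 | Module.finrank K L • c = 0} :=
  Set.ext fun c => mem_range_unitsInfTwo_iff_nsmul_eq_zero K L c

/-! ## §2. `Br(L/K) ⊆ Br(L'/K)` when `[L:K] ∣ [L':K]`; the abstract inflation -/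

/-- **`[L:K] ∣ [L':K] ⟹ Br(L/K) ⊆ Br(L'/K)`** inside `Br(K)` (Serre XIII §3 Cor. 1 and Cor. 3: the
relative Brauer group of a local field depends only on the degree; for `L ⊆ L'` this is the inclusion
`Inf : H²(L/K) ↪ H²(L'/K)` of X §4 Prop. 6 read in `Br(K)`).
[cite: SerreLocalFields1979, Ch. XIII §3 Cor. 1 and Cor. 3 to Prop. 7] -/
theorem range_unitsInfTwo_subset_of_dvd (h : Module.finrank K L ∣ Module.finrank K L') :
    Set.range (unitsInfTwo K L) ⊆ Set.range (unitsInfTwo K L') := by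
  intro c hc
  rw [mem_range_unitsInfTwo_iff_nsmul_eq_zero] at hc ⊢
  obtain ⟨d, hd⟩ := h
  rw [hd, mul_comm, ← smul_smul, hc, nsmul_zero]

/-- **`Br(L/K)` depends only on `[L:K]`** (Serre XIII §3 Cor. 3): layers of the same degree have the same
relative Brauer group. [cite: SerreLocalFields1979, Ch. XIII §3 Cor. 3 to Prop. 7] -/
theorem range_unitsInfTwo_eq_of_finrank_eq (h : Module.finrank K L = Module.finrank K L') :
    Set.range (unitsInfTwo K L) = Set.range (unitsInfTwo K L') :=
  Set.Subset.antisymm (range_unitsInfTwo_subset_of_dvd K L L' (h ▸ dvd_rfl))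
    (range_unitsInfTwo_subset_of_dvd K L' L (h ▸ dvd_rfl))

/-- **The abstract inflation `H²(L/K) ↪ H²(L'/K)` for `[L:K] ∣ [L':K]`**: every class of
`H²(Gal(L/K), Lˣ)` has the Brauer class of EXACTLY ONE class of `H²(Gal(L'/K), L'ˣ)` (existence by §2,
uniqueness by `unitsInfTwo_injective`).  For `L ⊆ L'` the function so defined is the inflation of
Serre X §4 Prop. 6 viewed in `Br(K)`. [cite: SerreLocalFields1979, Ch. X §4 Prop. 6]
[cite: SerreLocalFields1979, Ch. XIII §3 Cor. 3 to Prop. 7] -/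
theorem existsUnique_unitsInfTwo_eq_of_dvd (h : Module.finrank K L ∣ Module.finrank K L')
    (x : groupCohomology (Rep.ofAlgebraAutOnUnits K L) 2) :
    ∃! x' : groupCohomology (Rep.ofAlgebraAutOnUnits K L') 2, unitsInfTwo K L' x' = unitsInfTwo K L x := by
  obtain ⟨x', hx'⟩ := range_unitsInfTwo_subset_of_dvd K L L' h ⟨x, rfl⟩
  exact ⟨x', hx', fun y hy => unitsInfTwo_injective K L' (hy.trans hx'.symm)⟩

/-! ## §3. Coherence of the canonical classes: `Inf u_{L/K} = [L':L] · u_{L'/K}` in `Br(K)` -/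

omit [ValuativeRel K] [TopologicalSpace K] [IsNonarchimedeanLocalField K] [CharZero K] in
/-- `1/n ∈ ℚ/ℤ` written uniformly: `zmodToQmodZ n 1 = ↑(1/n)` for every `n ≥ 1` (for `n = 1` both sides
vanish). [cite: SerreLocalFields1979, Ch. XIII §3 (`H²(K_n/K) ≅ (1/n)ℤ/ℤ`)] -/
theorem zmodToQmodZ_one_eq (n : ℕ) [NeZero n] :
    zmodToQmodZ n 1 = (((1 : ℚ) / n : ℚ) : AddCircle (1 : ℚ)) := by
  have h := Literature.NumberTheory.GaloisCohomology.zmodToQmodZ_intCast (n := n) 1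
  rwa [Int.cast_one, Int.cast_one] at h

omit [ValuativeRel K] [TopologicalSpace K] [IsNonarchimedeanLocalField K] [CharZero K] in
/-- `d · (1/(n d)) = 1/n` in `ℚ/ℤ`. [cite: SerreLocalFields1979, Ch. XI §3 (`inv_E ∘ Res = [E:K] · inv_K`, numerics)] -/
theorem nsmul_zmodToQmodZ_one_mul (n d : ℕ) [NeZero n] [NeZero d] [NeZero (n * d)] :
    d • zmodToQmodZ (n * d) 1 = zmodToQmodZ n 1 := by
  rw [zmodToQmodZ_one_eq, zmodToQmodZ_one_eq, ← AddCircle.coe_nsmul, nsmul_eq_mul]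
  congr 1
  have hn : (n : ℚ) ≠ 0 := Nat.cast_ne_zero.2 (NeZero.ne n)
  have hd : (d : ℚ) ≠ 0 := Nat.cast_ne_zero.2 (NeZero.ne d)
  rw [Nat.cast_mul]
  field_simp

variable {n n' d : ℕ} [NeZero n] [NeZero n']

/-- **Coherence of the canonical fundamental classes along a tower** ("`Inf u_{L/K} = [L':L] · u_{L'/K}`",
the class-formation axiom of Serre XI §3 / Neukirch II §1 (1.3), in `Br(K)`): if `[L:K] = n`,
`[L':K] = n' = n · d`, `inv(u) = 1/n` and `inv(u') = 1/n'`, then `u` and `d · u'` have the SAME Brauer class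
`unitsInfTwo K L u = unitsInfTwo K L' (d • u')`.  (For `L ⊆ L'`, `d = [L':L]` and the left side is
`Inf u`; by `range_brauerInvariantEquiv_unitsInfTwo` the hypotheses force `n ∣ [L:K]`, `n' ∣ [L':K]`, and
the statement needs nothing else.)
[cite: SerreLocalFields1979, Ch. XI §3 and Ch. XIII §4][cite: Neukirch2013, Part II §1 Def. (1.3)] -/
theorem unitsInfTwo_eq_unitsInfTwo_nsmul_of_inv_eq (hd : n * d = n')
    {u : groupCohomology (Rep.ofAlgebraAutOnUnits K L) 2}
    (hu : brauerInvariantEquiv K (unitsInfTwo K L u) = zmodToQmodZ n 1)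
    {u' : groupCohomology (Rep.ofAlgebraAutOnUnits K L') 2}
    (hu' : brauerInvariantEquiv K (unitsInfTwo K L' u') = zmodToQmodZ n' 1) :
    unitsInfTwo K L u = unitsInfTwo K L' (d • u') := by
  haveI : NeZero d := ⟨fun h => NeZero.ne n' (by rw [← hd, h, mul_zero])⟩
  haveI : NeZero (n * d) := ⟨by rw [hd]; exact NeZero.ne n'⟩
  apply (brauerInvariantEquiv K).injective
  rw [map_nsmul, map_nsmul, hu, hu']
  subst hd
  exact (nsmul_zmodToQmodZ_one_mul n d).symm

/-- **Layers of the same degree have canonical classes with the same Brauer class** (`d = 1`): e.g.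
every Galois layer of degree `m` has `unitsInfTwo u_{L/K} = unitsInfTwo u_{K_m/K} = unitsInfTwo (−[c_σ·π_K])`
(the unramified class, `eq_neg_frobeniusCocycle_of_inv_eq`) — Serre XIII §3 Prop. 7: every Brauer class of
a local field is split by the unramified extension of the same degree.
[cite: SerreLocalFields1979, Ch. XIII §3 Prop. 7 and Cor. 3] -/
theorem unitsInfTwo_eq_of_inv_eq
    {u : groupCohomology (Rep.ofAlgebraAutOnUnits K L) 2}
    (hu : brauerInvariantEquiv K (unitsInfTwo K L u) = zmodToQmodZ n 1)
    {u' : groupCohomology (Rep.ofAlgebraAutOnUnits K L') 2}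
    (hu' : brauerInvariantEquiv K (unitsInfTwo K L' u') = zmodToQmodZ n 1) :
    unitsInfTwo K L u = unitsInfTwo K L' u' := by
  have h := unitsInfTwo_eq_unitsInfTwo_nsmul_of_inv_eq K L L' (d := 1) (mul_one n) hu hu'
  rwa [one_nsmul] at h

/-- **The abstract inflation carries `u_{L/K}` to `[L':L] · u_{L'/K}`**: with the notation of
`unitsInfTwo_eq_unitsInfTwo_nsmul_of_inv_eq`, the unique class `x'` of `H²(L'/K)` with the Brauer class of
`u_{L/K}` (`existsUnique_unitsInfTwo_eq_of_dvd`) is `d · u_{L'/K}`.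
[cite: SerreLocalFields1979, Ch. XI §3 and Ch. XIII §4] -/
theorem eq_nsmul_of_unitsInfTwo_eq_of_inv_eq (hd : n * d = n')
    {u : groupCohomology (Rep.ofAlgebraAutOnUnits K L) 2}
    (hu : brauerInvariantEquiv K (unitsInfTwo K L u) = zmodToQmodZ n 1)
    {u' : groupCohomology (Rep.ofAlgebraAutOnUnits K L') 2}
    (hu' : brauerInvariantEquiv K (unitsInfTwo K L' u') = zmodToQmodZ n' 1)
    {x' : groupCohomology (Rep.ofAlgebraAutOnUnits K L') 2} (hx' : unitsInfTwo K L' x' = unitsInfTwo K L u) :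
    x' = d • u' :=
  unitsInfTwo_injective K L' (hx'.trans (unitsInfTwo_eq_unitsInfTwo_nsmul_of_inv_eq K L L' hd hu hu'))

/-- **Invariants are inflation-invariant**: classes of `H²(L/K)` and `H²(L'/K)` with the same Brauer
class have the same invariant (the class-formation axiom "`inv_{L'} ∘ Inf = inv_L`", Serre XI §3, here
tautological since both invariants are read through `Br(K)`); recorded for consumers.
[cite: SerreLocalFields1979, Ch. XI §3] -/
theorem inv_eq_of_unitsInfTwo_eq {x : groupCohomology (Rep.ofAlgebraAutOnUnits K L) 2}
    {x' : groupCohomology (Rep.ofAlgebraAutOnUnits K L') 2} (h : unitsInfTwo K L' x' = unitsInfTwo K L x) :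
    brauerInvariantEquiv K (unitsInfTwo K L' x') = brauerInvariantEquiv K (unitsInfTwo K L x) := by
  rw [h]

end Tower

end UnitsLayer

end Literature.NumberTheory.GaloisRepresentations

end
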